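import Summits.Parity.BatemanHorn.Theorems.SoloInformedThinRows
import Summits.Parity.BatemanHorn.Theorems.SoloInformedThinColumns
import Summits.Parity.BatemanHorn.Theorems.SoloInformedThinShortIntervalQ
import HarnessLib

/-!
# Thin sequences vs. Type-I/II information, XVII: sharp short-interval capstones

The decoupled forms of the short-interval capstones of `SoloInformedThinShortInterval(Q)`,
obtained from the good-rows Type-I theorem (`SoloInformedThinRows`) and the column-sparse
Type-II theorem (`SoloInformedThinColumns`).  For every real `a` with at most `x^{1−c}` non-zero
values on `(x/2, x]` and Ford–Maynard's comparison sequence `x/(2y)·1_{(x−y,x]}`,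
`x^{1−η}/2 ≤ y ≤ x/2`:

* (II) fails in `[θ, θ + ν]` whenever `θ < c`, `η < c` and `θ + η < 1`
  (`eventually_not_typeII_shortInterval_sharp`; columns `{pn}` of the interval have mass
  `≤ x^κ + x^η`, `shortInterval_col`);
* (I) fails at level `x^γ` whenever `γ > 1 − c` and `0 ≤ η < c`
  (`eventually_not_typeI_shortInterval_sharp`), and, for the twisted sequences
  `(xq/2)/(yφ(q))·1_{x−y<n≤x,(n,q)=1}` of Lemma 4.6, whenever `γ > 1 − c` and `2x^κ q ≤ y`
  for some `κ > 1 − c` — with no height condition at all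
  (`eventually_not_typeI_shortInterval_coprime_sharp`).

`η < c` is necessary (an interval of length `< x^{1−c}` may lie inside the support, and then
`a = b` on integers satisfies (I) and (II) trivially).  Consequently neither (I) above the
density nor (II) below it can be certified for a support of size `x^{1−c}` by comparison with
any of these sequences; cf. [cite: FordMaynard2024PrimeSieves, §2.4].

References: [cite: FordMaynard2024PrimeSieves, §1] [cite: FordMaynard2024PrimeSieves, §2.4]
[cite: FordMaynard2024PrimeSieves, §4.2 (Lemma 4.6)].
-/

noncomputable section

open Filter Finset Real

namespace Summit.Parity.BatemanHorn.Theorems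

open Literature.Barriers.Parity.FordMaynard (TypeI TypeII eventually_mul_rpow_le_rpow)

/-- The primes (or integers) `p ∈ P` with `x − y < pn ≤ x` number at most `y/n + 1` (`n ≥ 1`,
`0 ≤ y ≤ x`). [folklore] -/
theorem card_filter_mul_mem_short_le {x y : ℝ} (hy0 : 0 ≤ y) (hyx : y ≤ x) (P : Finset ℕ)
    {n : ℕ} (hn : 0 < n) :
    (((P.filter (fun p : ℕ => x - y < (p * n : ℝ) ∧ (p * n : ℝ) ≤ x)).card : ℕ) : ℝ)
      ≤ y / n + 1 := by
  have hn' : (0 : ℝ) < n := by exact_mod_cast hn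
  have hsub : P.filter (fun p : ℕ => x - y < (p * n : ℝ) ∧ (p * n : ℝ) ≤ x) ⊆
      Ioc ⌊(x - y) / n⌋₊ ⌊x / n⌋₊ := by
    intro p hp
    rw [Finset.mem_filter] at hp
    obtain ⟨_, h1, h2⟩ := hp
    rw [mem_Ioc]
    constructor
    · have : (x - y) / n < p := by
        rw [div_lt_iff₀ hn']
        linarith
      exact (Nat.floor_lt (div_nonneg (by linarith) hn'.le)).mpr this
    · have : (p : ℝ) ≤ x / n := by
        rw [le_div_iff₀ hn']
        linarith
      exact Nat.le_floor this
  have hfl : ⌊(x - y) / n⌋₊ ≤ ⌊x / n⌋₊ :=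
    Nat.floor_le_floor (div_le_div_of_nonneg_right (by linarith) hn'.le)
  have h2 : (⌊x / n⌋₊ : ℝ) ≤ x / n := Nat.floor_le (div_nonneg (by linarith) hn'.le)
  have h3 : (x - y) / n - 1 < ⌊(x - y) / n⌋₊ := Nat.sub_one_lt_floor _
  have h4 : x / n - (x - y) / n = y / n := by
    field_simp
    ring
  calc (((P.filter (fun p : ℕ => x - y < (p * n : ℝ) ∧ (p * n : ℝ) ≤ x)).card : ℕ) : ℝ)
        ≤ (((Ioc ⌊(x - y) / n⌋₊ ⌊x / n⌋₊).card : ℕ) : ℝ) := by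
          exact_mod_cast card_le_card hsub
    _ = (⌊x / n⌋₊ : ℝ) - ⌊(x - y) / n⌋₊ := by
          rw [Nat.card_Ioc, Nat.cast_sub hfl]
    _ ≤ y / n + 1 := by linarith

/-- **Columns of the short-interval sequence.**  For `n ≥ 1` and any finite `P`:
`∑_{p ∈ P, x/2 < pn ≤ x} x/(2y)·1_{(x−y,x]}(pn) ≤ x/(2n) + x/(2y)` (`0 < y ≤ x/2`). [folklore] -/
theorem shortInterval_col {x y : ℝ} (hy0 : 0 < y) (hyx : y ≤ x / 2) (P : Finset ℕ) {n : ℕ}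
    (hn : 0 < n) :
    ∑ p ∈ P.filter (fun p : ℕ => x / 2 < (p * n : ℝ) ∧ (p * n : ℝ) ≤ x),
        (Set.Ioc (x - y) x).indicator (fun _ : ℝ => x / (2 * y)) ((p * n : ℕ) : ℝ)
      ≤ x / (2 * n) + x / (2 * y) := by
  have hn' : (0 : ℝ) < n := by exact_mod_cast hn
  have hx : 0 ≤ x := by linarith
  have hv : 0 ≤ x / (2 * y) := by positivity
  set F : Finset ℕ := P.filter (fun p : ℕ => x / 2 < (p * n : ℝ) ∧ (p * n : ℝ) ≤ x) with hF
  have hind : ∀ p ∈ F, (Set.Ioc (x - y) x).indicator (fun _ : ℝ => x / (2 * y))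
      ((p * n : ℕ) : ℝ) = if x - y < (p * n : ℝ) ∧ (p * n : ℝ) ≤ x then x / (2 * y) else 0 := by
    intro p _
    by_cases h : ((p * n : ℕ) : ℝ) ∈ Set.Ioc (x - y) x
    · rw [Set.indicator_of_mem h]
      rw [Set.mem_Ioc] at h
      push_cast at h
      rw [if_pos h]
    · rw [Set.indicator_of_notMem h]
      rw [Set.mem_Ioc] at h
      push_cast at h
      rw [if_neg h]
  rw [sum_congr rfl hind, ← Finset.sum_filter, sum_const, nsmul_eq_mul]
  have hyx' : y ≤ x := by linarith
  have hcard := card_filter_mul_mem_short_le hy0.le hyx' F hn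
  calc (((F.filter (fun p : ℕ => x - y < (p * n : ℝ) ∧ (p * n : ℝ) ≤ x)).card : ℕ) : ℝ) *
        (x / (2 * y)) ≤ (y / n + 1) * (x / (2 * y)) := mul_le_mul_of_nonneg_right hcard hv
    _ = x / (2 * n) + x / (2 * y) := by
        field_simp
        try ring

/-- **Short intervals, Type II — sharp form.**  Let `0 ≤ θ < c ≤ 1`, `η < c`, `θ + η < 1`,
`ν > 0`, `B > 1`.  For all large `x`, every real `a` with at most `x^{1−c}` non-zero values on
`(x/2, x]` and every `x^{1−η}/2 ≤ y ≤ x/2`: `w = a − x/(2y)·1_{(x−y, x]}` violates (II) in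
`[θ, θ + ν]`.  (The conditions `θ < c` and `η < c` are decoupled; `SoloInformedThinShortInterval`
needed `θ + η < c`.  `η < c` is necessary: an interval of length `< x^{1−c}` may lie inside the
support.) [cite: FordMaynard2024PrimeSieves, §2.4] [cite: FordMaynard2024PrimeSieves, §4.2] -/
theorem eventually_not_typeII_shortInterval_sharp {c θ ν B η : ℝ} (hθ : 0 ≤ θ) (hθc : θ < c)
    (hηc : η < c) (hθη : θ + η < 1) (hc1 : c ≤ 1) (hν : 0 < ν) (hB : 1 < B) :
    ∀ᶠ x : ℝ in atTop, ∀ (a : ℕ → ℝ) (A : Finset ℕ) (y : ℝ), (A.card : ℝ) ≤ x ^ (1 - c) →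
      (∀ v : ℕ, x / 2 < (v : ℝ) → (v : ℝ) ≤ x → a v ≠ 0 → v ∈ A) →
      x ^ (1 - η) / 2 ≤ y → y ≤ x / 2 →
      ¬ TypeII (fun n : ℕ => a n -
        (Set.Ioc (x - y) x).indicator (fun _ : ℝ => x / (2 * y)) (n : ℝ)) x θ ν B := by
  -- `θ < κ < min(c, 1 − η)`, `max(κ, η) < σ < c`
  have hm1 : min c (1 - η) ≤ c := min_le_left _ _
  have hm2 : min c (1 - η) ≤ 1 - η := min_le_right _ _
  have hθm : θ < min c (1 - η) := lt_min hθc (by linarith)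
  set κ : ℝ := (θ + min c (1 - η)) / 2 with hκdef
  have hθκ : θ < κ := by rw [hκdef]; linarith
  have hκc : κ < c := by rw [hκdef]; linarith
  have hκη : κ < 1 - η := by rw [hκdef]; linarith
  have hκ0 : 0 < κ := by linarith
  have hM1 : κ ≤ max κ η := le_max_left _ _
  have hM2 : η ≤ max κ η := le_max_right _ _
  have hMc : max κ η < c := max_lt hκc hηc
  set σ : ℝ := (max κ η + c) / 2 with hσdef
  have hσc : σ < c := by rw [hσdef]; linarith
  have hMσ : max κ η < σ := by rw [hσdef]; linarith
  filter_upwards [eventually_not_typeII_of_sparse_col hθ hθc hc1 hσc hν hB hθκ,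
    eventually_mul_rpow_le_rpow 4 hκη, eventually_mul_rpow_le_rpow 2 hMσ,
    eventually_ge_atTop (1 : ℝ)] with x hx e1 e2 hx1 a A y hA hcov hy1 hy2
  have hx0 : 0 < x := by linarith
  have hy0 : 0 < y := lt_of_lt_of_le (by positivity) hy1
  have hb0 : ∀ n : ℕ, 0 ≤ (Set.Ioc (x - y) x).indicator (fun _ : ℝ => x / (2 * y)) (n : ℝ) :=
    fun n => Set.indicator_nonneg (fun _ _ => by positivity) _
  have hxy : x / (2 * y) ≤ x ^ η := by
    rw [div_le_iff₀ (by positivity)]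
    have h1 : x = x ^ (1 - η) * x ^ η := by
      rw [← Real.rpow_add hx0]; norm_num
    have h2 : x ^ (1 - η) * x ^ η ≤ (2 * y) * x ^ η :=
      mul_le_mul_of_nonneg_right (by linarith) (Real.rpow_nonneg hx0.le _)
    calc x = x ^ (1 - η) * x ^ η := h1
      _ ≤ (2 * y) * x ^ η := h2
      _ = x ^ η * (2 * y) := by ring
  refine hx a (fun n : ℕ => (Set.Ioc (x - y) x).indicator (fun _ : ℝ => x / (2 * y)) (n : ℝ))
    A ∅ hA hcov hb0 (by simp only [Finset.card_empty, Nat.cast_zero]; positivity) ?_ ?_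
  · -- columns: `≤ x/(2n) + x/(2y) ≤ x^κ + x^η ≤ x^σ`
    intro n
    rcases Nat.eq_zero_or_pos n with hn | hn
    · subst hn
      refine le_trans (le_of_eq (sum_eq_zero fun p _ => ?_)) (Real.rpow_nonneg hx0.le _)
      rw [Set.indicator_of_notMem]
      simp only [mul_zero, Nat.cast_zero, Set.mem_Ioc, not_and, not_le]
      intro h
      linarith
    · set P : Finset ℕ := (Icc 1 ⌊x ^ κ⌋₊).filter (fun p : ℕ => p.Prime ∧
          (x / 2) ^ θ < (p : ℝ) ∧ (x / 2 < (p * n : ℝ) ∧ (p * n : ℝ) ≤ x)) with hP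
      by_cases hPe : P = ∅
      · rw [hPe, sum_empty]; exact Real.rpow_nonneg hx0.le _
      · obtain ⟨p₀, hp₀⟩ := Finset.nonempty_iff_ne_empty.mpr hPe
        have hp₀' := hp₀
        rw [hP, Finset.mem_filter, mem_Icc] at hp₀'
        obtain ⟨⟨_, hp₀κ⟩, _, _, hp₀n, _⟩ := hp₀'
        have hp₀x : (p₀ : ℝ) ≤ x ^ κ :=
          le_trans (by exact_mod_cast hp₀κ) (Nat.floor_le (Real.rpow_nonneg hx0.le _))
        have hn' : (0 : ℝ) < n := by exact_mod_cast hn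
        have hxn : x / (2 * n) ≤ x ^ κ := by
          rw [div_le_iff₀ (by positivity)]
          nlinarith
        have hsub : P ⊆ (Icc 1 ⌊x ^ κ⌋₊).filter
            (fun p : ℕ => x / 2 < (p * n : ℝ) ∧ (p * n : ℝ) ≤ x) := by
          intro p hp
          rw [hP, Finset.mem_filter] at hp
          rw [Finset.mem_filter]
          exact ⟨hp.1, hp.2.2.2⟩
        calc ∑ p ∈ P, (Set.Ioc (x - y) x).indicator (fun _ : ℝ => x / (2 * y)) ((p * n : ℕ) : ℝ)
            ≤ ∑ p ∈ (Icc 1 ⌊x ^ κ⌋₊).filter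
                (fun p : ℕ => x / 2 < (p * n : ℝ) ∧ (p * n : ℝ) ≤ x),
                (Set.Ioc (x - y) x).indicator (fun _ : ℝ => x / (2 * y)) ((p * n : ℕ) : ℝ) :=
              sum_le_sum_of_subset_of_nonneg hsub (fun p _ _ => hb0 (p * n))
          _ ≤ x / (2 * n) + x / (2 * y) := shortInterval_col hy0 hy2 _ hn
          _ ≤ x ^ κ + x ^ η := by linarith
          _ ≤ 2 * x ^ (max κ η) := by
              have h1 : x ^ κ ≤ x ^ (max κ η) := Real.rpow_le_rpow_of_exponent_le hx1 hM1
              have h2 : x ^ η ≤ x ^ (max κ η) := Real.rpow_le_rpow_of_exponent_le hx1 hM2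
              linarith
          _ ≤ x ^ σ := e2
  · intro p hp _ _ hpκ
    have hpy : 2 * (p : ℝ) ≤ y := by linarith
    exact shortInterval_mass hp.pos hpy hy2

/-- **Short intervals, Type I — sharp form.**  Let `0 ≤ η < c ≤ 1`, `γ > 1 − c`, `B > 1`.  For
all large `x`, every real `a` with at most `x^{1−c}` non-zero values on `(x/2, x]` and every
`x^{1−η}/2 ≤ y ≤ x/2`: `w = a − x/(2y)·1_{(x−y, x]}` violates (I) at level `x^γ`.  (No height
coupling: `SoloInformedThinShortInterval` needed `γ > 1 − c + η`, `2η < c`.)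
[cite: FordMaynard2024PrimeSieves, §2.4] [cite: FordMaynard2024PrimeSieves, §4.2] -/
theorem eventually_not_typeI_shortInterval_sharp {c γ B η : ℝ} (hη : 0 ≤ η) (hηc : η < c)
    (hc1 : c ≤ 1) (hγ : 1 - c < γ) (hB : 1 < B) :
    ∀ᶠ x : ℝ in atTop, ∀ (a : ℕ → ℝ) (A : Finset ℕ) (y : ℝ), (A.card : ℝ) ≤ x ^ (1 - c) →
      (∀ v : ℕ, x / 2 < (v : ℝ) → (v : ℝ) ≤ x → a v ≠ 0 → v ∈ A) →
      x ^ (1 - η) / 2 ≤ y → y ≤ x / 2 →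
      ¬ TypeI (fun n : ℕ => a n -
        (Set.Ioc (x - y) x).indicator (fun _ : ℝ => x / (2 * y)) (n : ℝ)) x γ B := by
  have hc0 : 0 < c := by linarith
  set κ : ℝ := ((1 - c) + (1 - η)) / 2 with hκdef
  have hκc : 1 - c < κ := by rw [hκdef]; linarith
  have hκη : κ < 1 - η := by rw [hκdef]; linarith
  filter_upwards [eventually_not_typeI_of_sparse_rows hc0 hc1 hγ hB hκc,
    eventually_mul_rpow_le_rpow 4 hκη, eventually_ge_atTop (1 : ℝ)]
    with x hx e1 hx1 a A y hA hcov hy1 hy2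
  have hx0 : 0 < x := by linarith
  have hy0 : 0 < y := lt_of_lt_of_le (by positivity) hy1
  have hb0 : ∀ n : ℕ, 0 ≤ (Set.Ioc (x - y) x).indicator (fun _ : ℝ => x / (2 * y)) (n : ℝ) :=
    fun n => Set.indicator_nonneg (fun _ _ => by positivity) _
  refine hx a (fun n : ℕ => (Set.Ioc (x - y) x).indicator (fun _ : ℝ => x / (2 * y)) (n : ℝ))
    A ∅ hA hcov hb0 (by simp only [Finset.card_empty, Nat.cast_zero]; positivity) ?_
  intro p hp _ hpκ
  have hpy : 2 * (p : ℝ) ≤ y := by linarith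
  exact shortInterval_mass hp.pos hpy hy2

/-- **Short intervals with a modulus, Type I — sharp form (no height condition).**  Let
`0 < c ≤ 1`, `γ > 1 − c`, `κ > 1 − c`, `B > 1`.  For all large `x`, every real `a` with at most
`x^{1−c}` non-zero values on `(x/2, x]`, every `q ≥ 1` and every `y ≤ x/2` with `2 x^κ q ≤ y`:
`w = a − b` violates (I) at level `x^γ` for Ford–Maynard's
`b_n = (xq/2)/(yφ(q))·1_{x−y<n≤x, (n,q)=1}` (Lemma 4.6).
[cite: FordMaynard2024PrimeSieves, §4.2 (Lemma 4.6)] -/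
theorem eventually_not_typeI_shortInterval_coprime_sharp {c γ B κ : ℝ} (hc0 : 0 < c)
    (hc1 : c ≤ 1) (hγ : 1 - c < γ) (hB : 1 < B) (hκ : 1 - c < κ) :
    ∀ᶠ x : ℝ in atTop, ∀ (a : ℕ → ℝ) (A : Finset ℕ) (y : ℝ) (q : ℕ), (A.card : ℝ) ≤ x ^ (1 - c) →
      (∀ v : ℕ, x / 2 < (v : ℝ) → (v : ℝ) ≤ x → a v ≠ 0 → v ∈ A) → 0 < q →
      2 * x ^ κ * q ≤ y → y ≤ x / 2 →
      ¬ TypeI (fun n : ℕ => a n - (if x - y < (n : ℝ) ∧ (n : ℝ) ≤ x ∧ Nat.Coprime n q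
        then x * q / (2 * y * (q.totient : ℝ)) else 0)) x γ B := by
  have hκ0 : 0 ≤ κ := by linarith
  filter_upwards [eventually_not_typeI_of_sparse_rows_coprime hc0 hc1 hγ hB hκ,
    eventually_ge_atTop (1 : ℝ)] with x hx hx1 a A y q hA hcov hq hqy hyx
  have hx0 : 0 < x := by linarith
  have hq1 : (1 : ℝ) ≤ q := by exact_mod_cast hq
  have hxκ : 1 ≤ x ^ κ := Real.one_le_rpow hx1 hκ0
  have hqκ : (q : ℝ) ≤ x ^ κ * q := le_mul_of_one_le_left (by positivity) hxκ
  have hy0 : 0 < y := by linarith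
  have hφ : (0 : ℝ) < (q.totient : ℝ) := by exact_mod_cast Nat.totient_pos.mpr hq
  have hb0 : ∀ n : ℕ, 0 ≤ (if x - y < (n : ℝ) ∧ (n : ℝ) ≤ x ∧ Nat.Coprime n q
      then x * q / (2 * y * (q.totient : ℝ)) else 0) := by
    intro n
    split_ifs
    · positivity
    · exact le_rfl
  refine hx a (fun n : ℕ => if x - y < (n : ℝ) ∧ (n : ℝ) ≤ x ∧ Nat.Coprime n q
      then x * q / (2 * y * (q.totient : ℝ)) else 0) A q hA hcov hb0 hq ?_ ?_
  · have hxx : x ≤ x ^ 2 := by nlinarith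
    linarith
  · intro p hp hndvd hpκ
    have hpq : Nat.Coprime p q := (Nat.Prime.coprime_iff_not_dvd hp).mpr hndvd
    have hp2 : 2 * (p : ℝ) * q ≤ y := by
      have : (p : ℝ) * q ≤ x ^ κ * q := mul_le_mul_of_nonneg_right hpκ (by positivity)
      linarith
    exact shortIntervalQ_mass hp.pos hq hpq hp2 hyx

end Summit.Parity.BatemanHorn.Theorems

end
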